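import Summits.BirchSwinnertonDyer.BirchSwinnertonDyer.Theorems.CyclotomicUntwistModThreeNonsplitLineImage
import Summits.BirchSwinnertonDyer.BirchSwinnertonDyer.Theorems.CyclotomicUntwistStableLineCubeClass
import Summits.BirchSwinnertonDyer.BirchSwinnertonDyer.Theorems.CyclotomicUntwistPSLocalThreeStableLineIIstar
import Summits.BirchSwinnertonDyer.BirchSwinnertonDyer.Theorems.CyclotomicUntwistWildThreeTameTorsionCellLaw
import Summits.BirchSwinnertonDyer.Rank1Residual.Additive.WildThreeStableLineSignByC6
import Literature.NumberTheory.EllipticCurves.SemistableModPImageIrreducibleProofs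
import Literature.NumberTheory.EllipticCurves.LocalKummerIsotropyTransport
import Literature.NumberTheory.EllipticCurves.NonEisensteinPrimeOfSurjective
import HarnessLib

/-!
# LAW L-irr3: one stable line of `E[3]` at `3` and `E[3]` irreducible force `ρ̄_{E,3}` onto — in
# particular `Irr ↔ Surj` at `3` on the whole cyclic wild cell and off the `3`-adic cube class

Cell `pub/bsd-wall` (D-0145 line `route-BirchSwinnertonDyer-CyclotomicUntwist`), seat `bsd-line-cycu-p4`
(width seat 4, gen 6). Helper toward the cruxes K1 `PSRankOneLowerHalfAtThree`
(stmt-BirchSwinnertonDyer-21580) and K2 `PSRankOneUpperHalfAtThree` (stmt-21581). THEOREMS ONLY (no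
definition, no named fact, no `sorry`); route-free; BSD is not proved by this file and no crux is. Third
file of LAW L-irr3 (file 1 `…GLTwoFThreeSecondEigenline`: the `GL₂(𝔽₃)` core; file 2
`…ModThreeNonsplitLineImage`: a unique stable line gives `σ` with `3 ∣ ord ρ̄(σ)`).

* §1 (any field `K` of characteristic `0`) — from ROOTS of `Ψ₃` to stable lines: a stable line `{0, ±P}`
  sits above a `K`-root of `Ψ₃` (`exists_isRoot_of_smul_eq`; Cremona §3.8), two lines above the same
  abscissa coincide (`zmultiples_eq_of_X_eq`), so "`Ψ₃` has a `K`-root and only one" gives a UNIQUE stable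
  order-`3` subgroup (`exists_unique_stable_of_roots`) and, by file 2, some `σ ∈ Γ_K` with
  `3 ∣ ord ρ̄(σ)` (`exists_three_dvd_orderOf_of_roots`).
* §2 (`E/ℚ`, `p = 3`) — local to global: along the restriction `Γ_{ℚ₃} → Γ_ℚ` and the tree's equivariant
  transfer `E[3](ℚ̄) ≃ E[3](ℚ̄₃)` (`torsionTransferEquiv`) the orders of `ρ̄(res σ)` and of the local
  `ρ̄(σ)` agree (`orderOf_galoisRepTorsion_absGaloisRestrict`); hence
  **`surj_three_of_irr_of_numStableLinesAtThree_eq_one`**: `numStableLinesAtThree W = 1 → Irr W 3 →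
  Surj W 3` for EVERY elliptic `W/ℚ` — `3` divides the order of the image, which is irreducible with
  surjective determinant, so it is `GL₂(𝔽₃)` (tree `not_dvd_card_of_not_hasSurjectiveModNGaloisRep`,
  Serre Prop. 15).
* §3 rows: `surj_three_iff_irr_of_not_cubeClass` (every globally minimal `W` with `3 ∤ v₃Δ_min` or
  `Δ_min/3^v ≢ ±1 (mod 9)`; p2's `numStableLinesAtThree_eq_one_of_not_cubeClass`),
  **`surj_three_iff_irr_of_cyclic`** (the whole cyclic wild cell `ClassO6 ∧ v` even ⊇ the PS rows of
  K1/K2; `numStableLinesAtThree_eq_one_of_psRow`), and `tameTorsionCell_of_irr_of_not_surj` (on the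
  wild cell O6 an irreducible-not-onto `ρ̄₃` lives on the two tame-torsion cells `(f₃, K₃) ∈
  {(3, II), (3, IV*)}` only — the census reading "PS/SCu irr-not-onto = 0" as a theorem).

Consequence for the route: the binder `Surj W 3` of K1/K2 may be read `Irr W 3` (equivalent on their
rows); the leaf `WAllExclAddWildRankOneSurj` restricted to the cyclic cell is the irreducible cyclic wild
cell. References: J.-P. Serre, Invent. Math. 15 (1972) §2.4 Prop. 15, §5.3 [Serre1972]; J. E. Cremona,
*Algorithms for Modular Elliptic Curves* (1997) §3.8 [Cremona1997]; J. H. Silverman, *AEC* (2009)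
III.4.12, Exercise 3.7 [SilvermanAEC2009]; A. Kraus, Manuscripta Math. 69 (1990) [Kraus1990].
-/

-- single-conjunct summit: `Summit.BirchSwinnertonDyer.BirchSwinnertonDyer.…` repeats the name by design
set_option linter.dupNamespace false
set_option autoImplicit false

noncomputable section

open scoped Classical

universe u

namespace Summit.BirchSwinnertonDyer.BirchSwinnertonDyer.Theorems.PSIrrSurjThree

open Polynomial WeierstrassCurve Field Literature.NumberTheory.EllipticCurves
  Literature.NumberTheory.EllipticCurves.Rank1Residual Literature.NumberTheory.GaloisRepresentations
  Summit.BirchSwinnertonDyer.Rank1Residual.Additive Summit.BirchSwinnertonDyer.Rank1Residual.O5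

/-! ### §1 From roots of `Ψ₃` to the unique stable line (any field of characteristic `0`) -/

section Roots

variable {K : Type u} [Field K] [CharZero K] (V : WeierstrassCurve K) [V.IsElliptic]

/-- Galois descent in `K̄/K`: an element fixed by every `K`-automorphism of `K̄` lies in `K`. [folklore] -/
theorem exists_algebraMap_eq_of_forall_smul_eq {x : AlgebraicClosure K}
    (hx : ∀ σ : AlgebraicClosure K ≃ₐ[K] AlgebraicClosure K, σ x = x) :
    ∃ c : K, algebraMap K (AlgebraicClosure K) c = x := by
  haveI : IsGalois K (AlgebraicClosure K) := {}
  exact (InfiniteGalois.mem_range_algebraMap_iff_fixed x).mpr hx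

omit [V.IsElliptic] in
/-- **A stable line sits above a `K`-root of `Ψ₃`.** If `P ≠ 0` in `E[3]` and `σ • P = ±P` for every
`σ ∈ Γ_K`, then `P = (x, y)` with `x ∈ K` a root of `Ψ₃` (the abscissa is `Γ_K`-fixed; `Ψ₃(x(P)) = 0`
for `3P = 0`). [cite: Cremona1997, §3.8 (l = 3: "just one x-coordinate, which must be rational")]
[cite: SilvermanAEC2009, III.4.12 and Exercise 3.7] -/
theorem exists_isRoot_of_smul_eq (P : geomTorsion V (3 : ℕ)) (hP0 : P ≠ 0)
    (hpm : ∀ σ : absoluteGaloisGroup K, σ • P = P ∨ σ • P = -P) :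
    ∃ (x y : AlgebraicClosure K) (h : (V.baseChange (AlgebraicClosure K)).toAffine.Nonsingular x y) (r : K),
      (P : geomPoints V) = Affine.Point.some x y h ∧ x = algebraMap K (AlgebraicClosure K) r ∧
        V.Ψ₃.IsRoot r := by
  obtain ⟨Q, hQmem⟩ := P
  have hQ0 : Q ≠ 0 := fun hQ ↦ hP0 (Subtype.ext hQ)
  change (V.baseChange (AlgebraicClosure K)).toAffine.Point at Q
  rcases Q with _ | ⟨x, y, hxy⟩
  · exact (hQ0 rfl).elim
  -- `σ x = x` for every `σ`
  have hx : ∀ σ : AlgebraicClosure K ≃ₐ[K] AlgebraicClosure K, σ x = x := by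
    intro σ
    rcases hpm σ with hσ | hσ
    · have hσ' := congrArg Subtype.val hσ
      change Affine.Point.map (σ : AlgebraicClosure K →ₐ[K] AlgebraicClosure K)
        (Affine.Point.some x y hxy) = Affine.Point.some x y hxy at hσ'
      rw [Affine.Point.map_some] at hσ'
      simpa only [Affine.Point.some.injEq, AlgEquiv.coe_toAlgHom] using (Affine.Point.some.inj hσ').1
    · have hσ' := congrArg Subtype.val hσ
      change Affine.Point.map (σ : AlgebraicClosure K →ₐ[K] AlgebraicClosure K)
        (Affine.Point.some x y hxy) = -Affine.Point.some x y hxy at hσ'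
      rw [Affine.Point.map_some, Affine.Point.neg_some] at hσ'
      simpa only [Affine.Point.some.injEq, AlgEquiv.coe_toAlgHom] using (Affine.Point.some.inj hσ').1
  obtain ⟨r, hr⟩ := exists_algebraMap_eq_of_forall_smul_eq hx
  have hΨ : (V.baseChange (AlgebraicClosure K)).Ψ₃.eval x = 0 :=
    V.eval_divisionPolynomial_three_eq_zero_of_eq_some (T := ⟨Affine.Point.some x y hxy, hQmem⟩) rfl
  refine ⟨x, y, hxy, r, rfl, hr.symm, ?_⟩
  rw [← hr, WeierstrassCurve.baseChange, map_Ψ₃, eval_map, eval₂_at_apply] at hΨ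
  exact (map_eq_zero_iff _ (algebraMap K (AlgebraicClosure K)).injective).mp hΨ

omit [CharZero K] [V.IsElliptic] in
/-- **Two lines above one abscissa coincide**: points `P₁ = (x, y₁)`, `P₂ = (x, y₂)` of `E[3]` with the
same `x` satisfy `P₂ = ±P₁`, so `{0, ±P₂} = {0, ±P₁}`. [cite: SilvermanAEC2009, III.2.3] -/
theorem zmultiples_eq_of_X_eq {P₁ P₂ : geomTorsion V (3 : ℕ)} {x y₁ y₂ : AlgebraicClosure K}
    {h₁ : (V.baseChange (AlgebraicClosure K)).toAffine.Nonsingular x y₁}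
    {h₂ : (V.baseChange (AlgebraicClosure K)).toAffine.Nonsingular x y₂}
    (hP₁ : (P₁ : geomPoints V) = Affine.Point.some x y₁ h₁)
    (hP₂ : (P₂ : geomPoints V) = Affine.Point.some x y₂ h₂) :
    AddSubgroup.zmultiples P₂ = AddSubgroup.zmultiples P₁ := by
  rcases Affine.Y_eq_of_X_eq h₂.left h₁.left rfl with hy | hy
  · subst hy
    have : P₂ = P₁ := Subtype.ext (by rw [hP₁, hP₂])
    rw [this]
  · subst hy
    have : P₂ = -P₁ := by
      apply Subtype.ext
      rw [NegMemClass.coe_neg, hP₁, hP₂]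
      change Affine.Point.some x _ h₂ = -Affine.Point.some x y₁ h₁
      rw [Affine.Point.neg_some]
    rw [this, AddSubgroup.zmultiples_neg]

/-- **"`Ψ₃` has exactly one `K`-root" ⟹ `E[3]` has exactly one stable line**: a `Γ_K`-stable subgroup
of order `3` exists (Cremona §3.8 via the tree's `not_hasIrreducibleModPGaloisRep_three_of_isRoot_Ψ₃` and
Mazur's dictionary) and any two coincide (they sit above `K`-roots, which coincide).
[cite: Cremona1997, §3.8 (l = 3)] [cite: SilvermanAEC2009, III.4.12, Remark III.4.13.2] -/
theorem exists_unique_stable_of_roots (hex : ∃ r : K, V.Ψ₃.IsRoot r)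
    (huniq : ∀ r₁ r₂ : K, V.Ψ₃.IsRoot r₁ → V.Ψ₃.IsRoot r₂ → r₁ = r₂) :
    ∃ H : AddSubgroup (geomTorsion V (3 : ℕ)),
      (∀ σ : absoluteGaloisGroup K, ∀ P ∈ H, σ • P ∈ H) ∧ Nat.card H = 3 ∧
      ∀ H' : AddSubgroup (geomTorsion V (3 : ℕ)),
        (∀ σ : absoluteGaloisGroup K, ∀ P ∈ H', σ • P ∈ H') → Nat.card H' = 3 → H' = H := by
  haveI : Fact (Nat.Prime 3) := ⟨Nat.prime_three⟩
  haveI : NeZero ((3 : ℕ) : K) := ⟨by norm_num⟩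
  obtain ⟨r, hr⟩ := hex
  obtain ⟨H, hH, hcard⟩ := (Mazur1978.not_hasIrreducibleModPGaloisRep_iff_exists_natCard_eq V 3).mp
    (V.not_hasIrreducibleModPGaloisRep_three_of_isRoot_Ψ₃ hr)
  refine ⟨H, hH, hcard, fun H' hH' hcard' ↦ ?_⟩
  obtain ⟨P, hP0, rfl⟩ := Mazur1978.exists_eq_zmultiples_of_natCard_eq V 3 hcard
  obtain ⟨P', hP'0, rfl⟩ := Mazur1978.exists_eq_zmultiples_of_natCard_eq V 3 hcard'
  obtain ⟨x, y, h, s, hP, hx, hs⟩ := exists_isRoot_of_smul_eq V P hP0 (smul_eq_or_eq_neg_of_stable V hP0 hH)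
  obtain ⟨x', y', h', s', hP', hx', hs'⟩ :=
    exists_isRoot_of_smul_eq V P' hP'0 (smul_eq_or_eq_neg_of_stable V hP'0 hH')
  have hss : s' = s := huniq s' s hs' hs
  have hxx : x' = x := by rw [hx, hx', hss]
  subst hxx
  exact zmultiples_eq_of_X_eq V hP hP'

/-- **"`Ψ₃` has exactly one `K`-root" ⟹ some `σ ∈ Γ_K` acts on `E[3]` with order divisible by `3`**
(`exists_unique_stable_of_roots` + file 2). [cite: Serre1972, §2.4 Prop. 15] [cite: Cremona1997, §3.8 (l = 3)] -/
theorem exists_three_dvd_orderOf_of_roots (hex : ∃ r : K, V.Ψ₃.IsRoot r)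
    (huniq : ∀ r₁ r₂ : K, V.Ψ₃.IsRoot r₁ → V.Ψ₃.IsRoot r₂ → r₁ = r₂) :
    ∃ σ : absoluteGaloisGroup K, 3 ∣ orderOf (galoisRepTorsion V (3 : ℕ) σ) := by
  obtain ⟨H, hH, hcard, hu⟩ := exists_unique_stable_of_roots V hex huniq
  exact exists_three_dvd_orderOf_of_unique_stableLine V H hH hcard hu

end Roots

/-! ### §2 Local to global at `p = 3` over `ℚ`, and the LAW -/

section Rat

variable (W : WeierstrassCurve ℚ) [W.IsElliptic]

/-- `ρ̄(g) = 1` iff `g` fixes `E[n]` pointwise. [folklore] -/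
theorem galoisRepTorsion_eq_one_iff {F : Type u} [Field F] (V : WeierstrassCurve F) (n : ℤ)
    (g : absoluteGaloisGroup F) : galoisRepTorsion V n g = 1 ↔ ∀ T : geomTorsion V n, g • T = T := by
  constructor
  · intro h T
    rw [← galoisRepTorsion_apply, h, toAdd_one, AddAut.zero_apply]
  · intro h
    apply Multiplicative.toAdd.injective
    rw [toAdd_one]
    ext T
    rw [galoisRepTorsion_apply, h, AddAut.zero_apply]

/-- **Local and global orders agree.** For `σ ∈ Γ_{ℚ₃}` and its restriction `res σ ∈ Γ_ℚ`, the order of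
`ρ̄_{E,3}(res σ)` on `E[3](ℚ̄)` equals the order of the local `ρ̄(σ)` on `E[3](ℚ̄₃)`: the transfer
`E[3](ℚ̄) ≃ E[3](ℚ̄₃)` is equivariant (tree `torsionTransferEquiv_smul`). [folklore] -/
theorem orderOf_galoisRepTorsion_absGaloisRestrict (σ : absoluteGaloisGroup ℚ_[3]) :
    orderOf (galoisRepTorsion W (3 : ℕ) (absGaloisRestrict ℚ ℚ_[3] σ)) =
      orderOf (galoisRepTorsion (W.baseChange ℚ_[3]) (3 : ℕ) σ) := by
  have hn : ((3 : ℕ) : ℤ) ≠ 0 := by norm_num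
  let t := W.torsionTransferEquiv (E := ℚ_[3]) hn
  rw [orderOf_eq_orderOf_iff]
  intro n
  rw [← map_pow, ← map_pow, ← map_pow, galoisRepTorsion_eq_one_iff, galoisRepTorsion_eq_one_iff]
  constructor
  · intro h S
    obtain ⟨T, rfl⟩ := t.surjective S
    rw [← W.torsionTransferEquiv_smul hn, h T]
  · intro h T
    apply t.injective
    rw [W.torsionTransferEquiv_smul hn]
    exact h (t T)

/-- **LAW L-irr3.** For every elliptic curve `E/ℚ` (any model `W`): if `E[3]|G_{ℚ₃}` has EXACTLY ONE stable
line (`numStableLinesAtThree W = 1`: `Ψ₃` has exactly one `ℚ₃`-root) and `E[3]` is an irreducible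
`Γ_ℚ`-module, then `ρ̄_{E,3} : Γ_ℚ → Aut E[3]` is onto. The unique line is non-split, so some `σ ∈ Γ_{ℚ₃}`
acts with order divisible by `3` (files 1–2, §1), hence so does `res σ ∈ Γ_ℚ`; an irreducible subgroup of
`GL₂(𝔽₃)` of order divisible by `3` with surjective determinant is everything (Serre Prop. 15, tree
`not_dvd_card_of_not_hasSurjectiveModNGaloisRep`). [cite: Serre1972, §2.4 Prop. 15 and §5.3]
[cite: Cremona1997, §3.8 (l = 3)] -/
theorem surj_three_of_irr_of_numStableLinesAtThree_eq_one (h1 : numStableLinesAtThree W = 1)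
    (hirr : Irr W 3) : Surj W 3 := by
  haveI : Fact (Nat.Prime 3) := ⟨Nat.prime_three⟩
  obtain ⟨x₀, hx₀, huq⟩ := (numStableLinesAtThree_eq_one_iff W).mp h1
  obtain ⟨σ, hσ⟩ := exists_three_dvd_orderOf_of_roots (W.baseChange ℚ_[3]) ⟨x₀, hx₀⟩
    (fun r₁ r₂ hr₁ hr₂ ↦ (huq r₁ hr₁).trans (huq r₂ hr₂).symm)
  rw [← orderOf_galoisRepTorsion_absGaloisRestrict W σ] at hσ
  by_contra hns
  obtain ⟨e, Φ, he, -⟩ := W.exists_frame_galoisRepTorsion_rat 3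
  refine W.not_dvd_card_of_not_hasSurjectiveModNGaloisRep 3 Φ e he hirr hns (hσ.trans ?_)
  rw [← MulEquiv.orderOf_eq Φ]
  exact Subgroup.orderOf_dvd_natCard _ (W.apply_galoisRepTorsion_mem_map_range 3 Φ _)

/-- `Surj ⇒ Irr` always (tree); so under one stable line at `3`, **`Surj W 3 ↔ Irr W 3`**.
[cite: Serre1972, §2.4 Prop. 15] -/
theorem surj_three_iff_irr_of_numStableLinesAtThree_eq_one (h1 : numStableLinesAtThree W = 1) :
    Surj W 3 ↔ Irr W 3 := by
  haveI : Fact (Nat.Prime 3) := ⟨Nat.prime_three⟩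
  haveI : NeZero ((3 : ℕ) : ℚ) := ⟨by norm_num⟩
  exact ⟨fun h ↦ hasIrreducibleModPGaloisRep_of_hasSurjectiveModNGaloisRep W 3 h,
    surj_three_of_irr_of_numStableLinesAtThree_eq_one W h1⟩

end Rat

/-! ### §3 The rows: off the cube class, the cyclic wild cell, the tame-torsion residue -/

section Rows

variable (W : WeierstrassCurve ℚ) [W.IsElliptic] [W.IsGloballyMinimal]

/-- **Off the `3`-adic cube class, `Irr ↔ Surj` at `3`.** For a globally minimal `W/ℚ` with
`3 ∤ v₃(Δ_min)`, or with `Δ_min/3^v ≢ ±1 (mod 9)`: `Surj W 3 ↔ Irr W 3` (one stable line by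
`PSLocalThreeTorsion.numStableLinesAtThree_eq_one_of_not_cubeClass`). Covers every multiplicative `I_n`
with `3 ∤ n`, every additive row with `v₃Δ_min ∉ 3ℤ`, every good curve whose `Δ_min` is not a `3`-adic
cube. [cite: Serre1972, §2.4 Prop. 15 and §5.3] -/
theorem surj_three_iff_irr_of_not_cubeClass
    (h : ¬ 3 ∣ padicValInt 3 W.minimalDiscriminantInt ∨
      (W.minimalDiscriminantInt / 3 ^ padicValInt 3 W.minimalDiscriminantInt % 9 ≠ 1 ∧
        W.minimalDiscriminantInt / 3 ^ padicValInt 3 W.minimalDiscriminantInt % 9 ≠ 8)) :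
    Surj W 3 ↔ Irr W 3 :=
  surj_three_iff_irr_of_numStableLinesAtThree_eq_one W
    (PSLocalThreeTorsion.numStableLinesAtThree_eq_one_of_not_cubeClass W h)

/-- **On the cyclic wild cell at `3`, `Irr ⇒ Surj`**: `ClassO6 W 3` (wild additive, potentially good) with
`v₃(Δ_min)` even (principal-series ∪ SCu rows, Kodaira `II/IV/IV*/II*` at `v = 4/6/10/12`) and `E[3]`
irreducible ⟹ `ρ̄_{E,3}` onto (one stable line by `PSLocalThreeTorsion.numStableLinesAtThree_eq_one_of_psRow`).
[cite: Kraus1990, Théorème (p = 3)] [cite: Serre1972, §2.4 Prop. 15] -/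
theorem surj_three_of_irr_of_cyclic (hO6 : ClassO6 W 3) (hev : Even (padicValInt 3 W.minimalDiscriminantInt))
    (hirr : Irr W 3) : Surj W 3 :=
  surj_three_of_irr_of_numStableLinesAtThree_eq_one W
    (PSLocalThreeTorsion.numStableLinesAtThree_eq_one_of_psRow W hO6 hev) hirr

/-- **On the cyclic wild cell at `3`, `Surj W 3 ↔ Irr W 3`** — the binder `Surj W 3` of the cruxes
`PSRankOneLowerHalfAtThree` / `PSRankOneUpperHalfAtThree` is irreducibility on their rows; there is no
"irreducible, not onto" cyclic wild row (census PS/SCu irr-not-onto = 0, now a theorem).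
[cite: Kraus1990, Théorème (p = 3)] [cite: Serre1972, §2.4 Prop. 15] -/
theorem surj_three_iff_irr_of_cyclic (hO6 : ClassO6 W 3) (hev : Even (padicValInt 3 W.minimalDiscriminantInt)) :
    Surj W 3 ↔ Irr W 3 :=
  surj_three_iff_irr_of_numStableLinesAtThree_eq_one W
    (PSLocalThreeTorsion.numStableLinesAtThree_eq_one_of_psRow W hO6 hev)

/-- **The irreducible-not-onto residue of the wild cell lies on the two tame-torsion cells.** On `ClassO6 W 3`,
`E[3]` irreducible and `ρ̄_{E,3}` NOT onto force `tameTorsionCellThree (f₃, K₃) = true`, i.e.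
`(f₃, K₃) ∈ {(3, II), (3, IV*)}` (elsewhere on O6 there is exactly one stable line,
`PSLocalThreeTorsion.numStableLinesAtThree_eq_one_of_not_tameTorsionCell`). [cite: Kraus1990, Théorème (p = 3)]
[cite: Serre1972, §2.4 Prop. 15] -/
theorem tameTorsionCell_of_irr_of_not_surj (hO6 : ClassO6 W 3) (hirr : Irr W 3) (hns : ¬ Surj W 3) :
    tameTorsionCellThree (condExp W 3) (W.kodairaSymbolAt (placeOf 3)) = true := by
  by_contra hcell
  rw [Bool.not_eq_true] at hcell
  exact hns (surj_three_of_irr_of_numStableLinesAtThree_eq_one W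
    (PSLocalThreeTorsion.numStableLinesAtThree_eq_one_of_not_tameTorsionCell W hO6 hcell) hirr)

end Rows

end Summit.BirchSwinnertonDyer.BirchSwinnertonDyer.Theorems.PSIrrSurjThree

end
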